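import Summits.ABC.IUTFork.Joshi.ArithHolStructureTiltResidueField
import HarnessLib

/-!
# The tilt is COMPLETE (and perfect): `(K♭, |·|_♭)` is a perfectoid field of characteristic `p` — MODEL / SUPPLY over p446090

Block E (rung LADDER-ABC:A2.E), seat abc-iut-E-t10 (gen 4); proof/model companion #2 of `ArithHolStructure.lean` (p431050→p437040;
[J-I] = Joshi, arXiv:2106.11452v4: §3.3 p.9 l.31–33 «one has naturally associated field K♭, algebraically closed, perfectoid of
characteristic p > 0, called the tilt of K» and Def. 4.1.1 (1) p.18 l.11ff, which types the tilt base `F` with Mathlib's classes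
`[NormedField F] [CompleteSpace F] [IsUltrametricDist F] [IsAlgClosed F] [CharP F p]`), over `ArithHolStructureTiltModel.lean` (p442777:
`normedFieldTilt U`, `flatInt`/`valFr`/`varpi`) and `ArithHolStructureTiltResidueField.lean` (p446090: `integers_valFr` — `𝒪_{K♭}` is the
valuation ring; `isUltrametricDist_tilt`). p442777's hand-off named this supply: **`CompleteSpace` for `(ATS1.tilt U, normedFieldTilt U)`**.
PROVED here, hypothesis-free, for every untilt `K` (E-t1's `Untilt p`):
* `coeff_eq_zero_iff`: in `𝒪_{K♭} = (𝒪_K/p)^perf`, **`f_n = 0 ⟺ |f|_♭ ≤ ‖p‖^{pⁿ}`** (`f_0 = f^♯ mod p`, `|f|_♭ = ‖f^♯‖`, and `f_n = (f^{1/pⁿ})_0`)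
  — the ideals `{f_0 = … = f_n = 0}` ARE the valuation balls, i.e. the inverse-limit topology of `lim_Φ 𝒪_K/p` is the `|·|_♭`-topology;
* `exists_coeff_limit`: a coefficientwise-Cauchy sequence in `lim_Φ 𝒪_K/p` has a limit (inverse limits of discrete sets);
* **`completeSpace_Fr` / `completeSpace_tilt U : CompleteSpace (ATS1.tilt U)`** for the metric of `normedFieldTilt U`: a `‖·‖_♭`-Cauchy
  sequence is bounded, is scaled by a power of `ϖ♭` into `𝒪_{K♭}` (`integers_valFr`), converges there coefficientwise, and is scaled back
  ([Scholze 2012, Lem. 3.4]: `𝒪_{K♭}` is `ϖ♭`-adically complete, `K♭ = 𝒪_{K♭}[1/ϖ♭]`);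
* `frobenius_surjective_Fr` / `frobenius_tilt_surjective`: `K♭` is PERFECT (`x ↦ x^p` onto; with `charP_tilt`, p431050).
UPSHOT for Def. 4.1.1's instance slots at `F := K♭` itself: `NormedField` (p442777 `normedFieldTilt`) · `CompleteSpace` (this file) ·
`IsUltrametricDist` (p446090) · `CharP _ p` (p431050 `charP_tilt`) are ALL supplied as explicit terms; the one slot NOT built is
`IsAlgClosed (tilt U)` ([Scholze 2012, Prop. 3.8]/[J-I] §3.3 «algebraically closed» — a theorem of its own, recorded not claimed), so
non-vacuity of `ArithHolStructure X A (tilt U)` remains open by exactly that slot (and the abstract Berkovich datum). All [folklore]; no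
claim of Joshi's used or asserted; no `Prop` hypothesis, instance, notation or FACT-LIST row introduced. A model exhibits satisfiability,
nothing more; no side taken on [IUTchIII] Cor. 3.12 or on any author. bears_on: LADDER-ABC:A2.E.
-/

noncomputable section

open scoped NNReal
open Filter Topology

namespace Summit.ABC.IUTFork.Joshi.ATS1

open Summit.ABC.IUTFork.Joshi

variable {p : ℕ} [Fact p.Prime]

namespace TiltModel

/-! ## 1. Coefficients of `(𝒪_K/p)^perf` versus `|·|_♭`: `f_n = 0 ⟺ |f|_♭ ≤ ‖p‖^{pⁿ}` -/

/-- `x ∈ (p) ⟺ ‖x‖ ≤ ‖p‖` in `𝒪_K` (p442777's `mem_span_pow_iff` at exponent `1`). [folklore] -/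
theorem mem_span_p_iff (U : Untilt p) {x : int U} : x ∈ Ideal.span {((p : ℕ) : int U)} ↔ ‖(x : U.K)‖ ≤ ‖(p : U.K)‖ := by
  simpa only [pow_one] using mem_span_pow_iff U (x := x) (n := 1)

section Integral

variable (U : Untilt p) [Fact (¬ IsUnit ((p : ℕ) : int U))] [IsAdicComplete (Ideal.span {((p : ℕ) : int U)}) (int U)]

/-- **`f_0 = 0 ⟺ |f|_♭ ≤ ‖p‖`**: `f_0 = f^♯ mod p` (Mathlib `mk_teichmuller₀`) and `|f|_♭ = ‖f^♯‖_K` (p442777). PROVED. [folklore] -/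
theorem coeff_zero_eq_zero_iff (f : PreTilt (int U) p) : PreTilt.coeff 0 f = 0 ↔ valInt U f ≤ ‖(p : U.K)‖₊ := by
  rw [PreTilt.coeff_def, ← Perfection.mk_teichmuller₀, Ideal.Quotient.eq_zero_iff_mem, mem_span_p_iff, valInt_eq_nnnorm,
    flatInt_apply_zero, ← NNReal.coe_le_coe, coe_nnnorm, coe_nnnorm]

/-- **`f_n = 0 ⟺ |f|_♭ ≤ ‖p‖^{pⁿ}`** (`f_n = (f^{1/pⁿ})_0`, `|f^{1/pⁿ}|_♭^{pⁿ} = |f|_♭`): the kernels of the truncations of `lim_Φ 𝒪_K/p`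
are exactly the `|·|_♭`-balls of radii `‖p‖^{pⁿ} → 0`. PROVED. [folklore] -/
theorem coeff_eq_zero_iff (f : PreTilt (int U) p) (n : ℕ) :
    PreTilt.coeff n f = 0 ↔ valInt U f ≤ ‖(p : U.K)‖₊ ^ p ^ n := by
  have hg : ((frobeniusEquiv (PreTilt (int U) p) p).symm^[n] f) ^ p ^ n = f :=
    iterate_frobeniusEquiv_symm_pow_p_pow (PreTilt (int U) p) p f n
  have hc : PreTilt.coeff n f = PreTilt.coeff 0 ((frobeniusEquiv (PreTilt (int U) p) p).symm^[n] f) := by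
    rw [PreTilt.coeff_iterate_frobeniusEquiv_symm, zero_add]
  rw [hc, coeff_zero_eq_zero_iff]
  conv_rhs => rw [← hg, map_pow]
  exact (pow_le_pow_iff_left₀ zero_le zero_le (pow_ne_zero n (Fact.out : p.Prime).ne_zero)).symm

/-- Two elements have the same `n`-th coefficient iff their difference is `‖p‖^{pⁿ}`-small. [folklore] -/
theorem coeff_eq_coeff_iff (f g : PreTilt (int U) p) (n : ℕ) :
    PreTilt.coeff n f = PreTilt.coeff n g ↔ valInt U (f - g) ≤ ‖(p : U.K)‖₊ ^ p ^ n := by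
  rw [← coeff_eq_zero_iff, map_sub, sub_eq_zero]

omit [IsAdicComplete (Ideal.span {((p : ℕ) : int U)}) (int U)] in
/-- **Inverse limits of discrete sets are complete**: a sequence in `(𝒪_K/p)^perf = lim_Φ 𝒪_K/p` whose `n`-th coefficients are eventually
constant, for every `n`, has a coefficientwise limit (take the eventual values along a monotone choice of thresholds; `p`-power
compatibility is inherited). PROVED. [folklore] -/
theorem exists_coeff_limit (a : ℕ → PreTilt (int U) p)
    (ha : ∀ n, ∃ N, ∀ k ≥ N, ∀ l ≥ N, PreTilt.coeff n (a k) = PreTilt.coeff n (a l)) :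
    ∃ b : PreTilt (int U) p, ∀ n, ∃ N, ∀ k ≥ N, PreTilt.coeff n (a k) = PreTilt.coeff n b := by
  choose N₀ hN₀ using ha
  let N : ℕ → ℕ := fun n => Nat.rec (N₀ 0) (fun m Nm => max (N₀ (m + 1)) Nm) n
  have hN0 : ∀ n, N₀ n ≤ N n := by
    intro n
    cases n with
    | zero => exact le_rfl
    | succ m => exact le_max_left _ _
  have hmono : ∀ n, N n ≤ N (n + 1) := fun n => le_max_right _ _
  have key : ∀ n k, N n ≤ k → PreTilt.coeff n (a k) = PreTilt.coeff n (a (N n)) :=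
    fun n k hk => hN₀ n k ((hN0 n).trans hk) (N n) (hN0 n)
  refine ⟨⟨fun n => PreTilt.coeff n (a (N n)), fun n => ?_⟩, fun n => ⟨N n, fun k hk => ?_⟩⟩
  · show PreTilt.coeff (n + 1) (a (N (n + 1))) ^ p = PreTilt.coeff n (a (N n))
    rw [PreTilt.coeff_pow_p]
    exact key n (N (n + 1)) (hmono n)
  · rw [key n k hk]
    rfl

end Integral

/-! ## 2. `(K♭, ‖·‖_♭)` is complete -/

section Frac

variable (U : Untilt p) [Fact (¬ IsUnit ((p : ℕ) : int U))] [IsDomain (PreTilt (int U) p)]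
  [IsAdicComplete (Ideal.span {((p : ℕ) : int U)}) (int U)]

/-- `‖a‖_♭ = |a|_♭` for integral `a` (as reals). [folklore] -/
theorem norm_algebraMap_eq (a : PreTilt (int U) p) :
    (letI := normedFieldFr U; ‖algebraMap _ (tiltFr U) a‖) = (valInt U a : ℝ) := by
  rw [norm_eq_valFr, valFr_algebraMap]

/-- `‖ϖ♭‖_♭ = ‖p‖_K`. [folklore] -/
theorem norm_varpiFr : (letI := normedFieldFr U; ‖algebraMap _ (tiltFr U) (varpi U)‖) = ‖(p : U.K)‖ := by
  rw [norm_algebraMap_eq, valInt_varpi, coe_nnnorm]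

/-- **`(K♭, ‖·‖_♭)` IS COMPLETE** ([Scholze 2012, Lem. 3.4]: `𝒪_{K♭}` is `ϖ♭`-adically complete and `K♭ = 𝒪_{K♭}[1/ϖ♭]`). A Cauchy
sequence `z_k` is bounded; `ϖ♭^m z_k ∈ 𝒪_{K♭}` for `m ≫ 0` (`integers_valFr`); there it is coefficientwise eventually constant
(`coeff_eq_coeff_iff`), so has a limit `b` (`exists_coeff_limit`); and `z_k → ϖ♭^{-m} b`. The `CompleteSpace` structure as an explicit
term for the metric of `normedFieldFr U`. PROVED. [folklore] -/
theorem completeSpace_Fr : letI := normedFieldFr U; CompleteSpace (tiltFr U) := by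
  letI nf : NormedField (tiltFr U) := normedFieldFr U
  refine Metric.complete_of_cauchySeq_tendsto fun z hz => ?_
  set π : tiltFr U := algebraMap _ (tiltFr U) (varpi U) with hπ
  have hπn : ‖π‖ = ‖(p : U.K)‖ := norm_varpiFr U
  have hp0 : 0 < ‖(p : U.K)‖ := norm_pos_iff.2 (natCast_p_ne_zero U)
  have hp1 : ‖(p : U.K)‖ < 1 := U.norm_p_lt_one
  have hπ0 : π ≠ 0 := by rw [← norm_pos_iff, hπn]; exact hp0
  -- (1) bounded; rescale into `𝒪_{K♭}`
  obtain ⟨R, hR⟩ := hz.norm_bddAbove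
  obtain ⟨m, hm⟩ : ∃ m : ℕ, ‖(p : U.K)‖ ^ m * R ≤ 1 := by
    rcases le_or_gt R 0 with h | h
    · exact ⟨0, by rw [pow_zero, one_mul]; exact h.trans zero_le_one⟩
    · obtain ⟨m, hm⟩ := exists_pow_lt_of_lt_one (inv_pos.2 h) hp1
      have h' := mul_lt_mul_of_pos_right hm h
      rw [inv_mul_cancel₀ h.ne'] at h'
      exact ⟨m, h'.le⟩
  have hw : ∀ k, ‖π ^ m * z k‖ ≤ 1 := fun k => by
    rw [norm_mul, norm_pow, hπn]
    exact (mul_le_mul_of_nonneg_left (hR ⟨k, rfl⟩) (pow_nonneg (norm_nonneg _) _)).trans hm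
  have hint : ∀ k, ∃ a : PreTilt (int U) p, algebraMap _ (tiltFr U) a = π ^ m * z k := fun k =>
    (integers_valFr U).exists_of_le_one (by
      have h := hw k
      rw [norm_eq_valFr] at h
      exact_mod_cast h)
  choose a ha using hint
  -- (2) the integral sequence is coefficientwise eventually constant
  have hcoeff : ∀ n, ∃ N, ∀ k ≥ N, ∀ l ≥ N, PreTilt.coeff n (a k) = PreTilt.coeff n (a l) := by
    intro n
    obtain ⟨N, hN⟩ := Metric.cauchySeq_iff.1 hz _ (pow_pos hp0 (p ^ n))
    refine ⟨N, fun k hk l hl => ?_⟩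
    rw [coeff_eq_coeff_iff, ← NNReal.coe_le_coe, NNReal.coe_pow, coe_nnnorm, ← norm_algebraMap_eq, map_sub, ha, ha, ← mul_sub,
      norm_mul, norm_pow, hπn]
    calc ‖(p : U.K)‖ ^ m * ‖z k - z l‖ ≤ 1 * ‖z k - z l‖ :=
          mul_le_mul_of_nonneg_right (pow_le_one₀ (norm_nonneg _) hp1.le) (norm_nonneg _)
      _ ≤ ‖(p : U.K)‖ ^ p ^ n := by rw [one_mul, ← dist_eq_norm]; exact (hN k hk l hl).le
  -- (3) the limit
  obtain ⟨b, hb⟩ := exists_coeff_limit U a hcoeff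
  refine ⟨(π ^ m)⁻¹ * algebraMap _ (tiltFr U) b, Metric.tendsto_atTop.2 fun ε hε => ?_⟩
  obtain ⟨n, hn⟩ := exists_pow_lt_of_lt_one (mul_pos hε (pow_pos hp0 m)) hp1
  obtain ⟨N, hN⟩ := hb n
  refine ⟨N, fun k hk => ?_⟩
  have hk' : valInt U (a k - b) ≤ ‖(p : U.K)‖₊ ^ p ^ n := (coeff_eq_coeff_iff U _ _ n).1 (hN k hk)
  have hsplit : z k - (π ^ m)⁻¹ * algebraMap _ (tiltFr U) b = (π ^ m)⁻¹ * (π ^ m * z k - algebraMap _ (tiltFr U) b) := by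
    rw [mul_sub, ← mul_assoc, inv_mul_cancel₀ (pow_ne_zero m hπ0), one_mul]
  rw [dist_eq_norm, hsplit, norm_mul, norm_inv, norm_pow, hπn, ← ha k, ← map_sub, norm_algebraMap_eq]
  calc (‖(p : U.K)‖ ^ m)⁻¹ * (valInt U (a k - b) : ℝ) ≤ (‖(p : U.K)‖ ^ m)⁻¹ * ‖(p : U.K)‖ ^ p ^ n := by
        gcongr; exact_mod_cast hk'
    _ ≤ (‖(p : U.K)‖ ^ m)⁻¹ * ‖(p : U.K)‖ ^ n :=
        mul_le_mul_of_nonneg_left (pow_le_pow_of_le_one hp0.le hp1.le (Nat.lt_pow_self (Fact.out : p.Prime).one_lt).le)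
          (inv_nonneg.2 (pow_nonneg hp0.le _))
    _ < ε := by rw [← div_eq_inv_mul, div_lt_iff₀ (pow_pos hp0 m)]; exact hn

omit [IsAdicComplete (Ideal.span {((p : ℕ) : int U)}) (int U)] in
/-- **`K♭` is PERFECT**: `x ↦ x^p` is onto `K♭ = Frac (𝒪_K/p)^perf` (`a/s = ((a^{1/p})/(s^{1/p}))^p`). PROVED. [folklore] -/
theorem frobenius_surjective_Fr : Function.Surjective (frobenius (tiltFr U) p) := fun z => by
  obtain ⟨⟨a, s⟩, rfl⟩ := IsLocalization.mk'_surjective (nonZeroDivisors (PreTilt (int U) p)) z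
  have hs : (frobeniusEquiv (PreTilt (int U) p) p).symm s ∈ nonZeroDivisors (PreTilt (int U) p) :=
    mem_nonZeroDivisors_of_ne_zero fun h => nonZeroDivisors.coe_ne_zero s (by
      rw [← frobeniusEquiv_symm_pow_p (PreTilt (int U) p) p (s : PreTilt (int U) p), h,
        zero_pow (Fact.out : p.Prime).ne_zero])
  refine ⟨IsLocalization.mk' (tiltFr U) ((frobeniusEquiv (PreTilt (int U) p) p).symm a) ⟨_, hs⟩, ?_⟩
  rw [frobenius_def, ← IsLocalization.mk'_pow]
  congr 1
  · exact frobeniusEquiv_symm_pow_p _ p a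
  · exact Subtype.ext (frobeniusEquiv_symm_pow_p _ p (s : PreTilt (int U) p))

end Frac

/-! ## 3. On `ATS1.tilt U` with `normedFieldTilt U`, hypothesis-free -/

/-- **`CompleteSpace (ATS1.tilt U)`** for the metric of `normedFieldTilt U` — the tilt of every untilt is a COMPLETE normed field; explicit
term, no hypotheses (the `[CompleteSpace F]` slot of Def. 4.1.1 at `F := K♭`). PROVED. [folklore] -/
theorem completeSpace_tilt (U : Untilt p) : letI := normedFieldTilt U; CompleteSpace (tilt U) :=
  haveI : Fact (¬ IsUnit ((p : ℕ) : int U)) := ⟨not_isUnit_p U⟩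
  haveI : IsDomain (PreTilt (int U) p) := isDomain_preTilt U
  haveI : IsAdicComplete (Ideal.span {((p : ℕ) : int U)}) (int U) := isAdicComplete_int U
  completeSpace_Fr U

/-- **The tilt is perfect**: Frobenius is onto `ATS1.tilt U` (characteristic `p` by p431050's `charP_tilt`) — with `completeSpace_tilt`,
`(K♭, ‖·‖_♭)` is a PERFECTOID FIELD of characteristic `p` in the sense of [J-I] §3.3 / [Scholze 2012, Lem. 3.4] (complete, perfect,
non-discretely valued: `|ϖ♭|_♭ = ‖p‖ ∈ (0,1)`). PROVED. [folklore] -/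
theorem frobenius_tilt_surjective (U : Untilt p) :
    haveI := charP_tilt U
    Function.Surjective (frobenius (tilt U) p) :=
  haveI : Fact (¬ IsUnit ((p : ℕ) : int U)) := ⟨not_isUnit_p U⟩
  haveI : IsDomain (PreTilt (int U) p) := isDomain_preTilt U
  haveI : IsAdicComplete (Ideal.span {((p : ℕ) : int U)}) (int U) := isAdicComplete_int U
  frobenius_surjective_Fr U

/-- **Def. 4.1.1's tilt-base slots at `F := K♭`, assembled**: the four structures `NormedField` (p442777), `CompleteSpace` (above),
`IsUltrametricDist` (p446090), `CharP _ p` (p431050) on `ATS1.tilt U`, packaged as one statement — everything `ArithHolStructure X A F`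
asks of `F` EXCEPT `IsAlgClosed` ([Scholze 2012, Prop. 3.8]; not built). Non-vacuity witness for those four slots. [folklore] -/
theorem tilt_slots (U : Untilt p) :
    letI := normedFieldTilt U
    CompleteSpace (tilt U) ∧ IsUltrametricDist (tilt U) ∧ CharP (tilt U) p :=
  ⟨completeSpace_tilt U, isUltrametricDist_tilt U, charP_tilt U⟩

end TiltModel

end Summit.ABC.IUTFork.Joshi.ATS1

end
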